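import Summits.QuantumFields.YangMills.Theorems.UnitScaleTiltProp7TrueLinReducedContraction
import Summits.QuantumFields.YangMills.Theorems.UnitScaleTiltProp7CurvedLandauRowA
import Summits.QuantumFields.YangMills.Theorems.UnitScaleTiltProp7LineIterVsEngineOfTower
import Summits.QuantumFields.YangMills.Theorems.UnitScaleTiltProp7TwistedLevelMassOfRegPr
import HarnessLib

/-!
# Route `UnitScaleTilt`, crux K1 «MinimiserStabilityRegPr» (stmt-QuantumFields-19200), LANE II (QH1)♮ — (QE′-H¹), part 2∕2:
# THE `H¹` ROW OF THE TRUE LINEARISED AVERAGE `Q^{E′}` AT A PRINTED-REGULAR MEMBER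

Cell `ym3-torus`, width seat `ym3-torus-px22` (gen 6).  THEOREMS ONLY (0 `def`, 0 `sorry`); `--supports stmt-QuantumFields-19200 --as helper`, count-neutral.
YM₃ on T³ is a ladder rung (R3) — NOT d = 4, NOT infinite volume, NOT a mass gap, NOT the Clay problem; nothing here claims a stub, the crux or the gap.

THE POINT (★p1 g19 LANE II NAMER WORDS №9–№11; px22 g6 LOCATE «(QH1) pencil» (P3)).  The (QH1)♮ knit needs, besides the corner-frame legs (R-LEGS), an `H¹`
row for the true linearised `(K−n)`-fold average `Q^{E′}_W` of the E′ recursion family (✓`Prop7CurvedLandauRowA.exists_trueLinIter_family`): in the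
`ℓ`-normalised currency `Q^{E′}` is NOT an `ℓ²`-contraction (op-norm² ≈ 3·ℓ, centre-stair point sampling) but it IS bounded by mass ⊕ `ℓ²·(CURL ⊕ DIV)`
⊕ curvature·mass with L-only constants.  Every ingredient is a landed theorem: the structure identity `Q_k = G_k + (Λ_k(c₋) − Ū(c)Λ_k(c₊)Ū(c)*)`
(✓`Prop7TrueLinIterStructure.trueLinIter_structure`), the `ℓ`-normalised contraction of the REDUCED family `G` (part 1∕2 ✓`Prop7TrueLinReducedContraction`),
★routeR-w2's curved N6 row for the coarse gauge function `Λ` in curl∕div letters (✓`Prop7CovIterLambdaHLambdaCurl.sum_normSq_covIterLambda_le_curl_T3_su2`),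
and the covariant coarse gradient in `ℓ²` (part 1∕2 §1).

* ★★★ `trueLinIter_H1_row_of_regPr` — `∀ L > 1 ∃ BE BE′ BE″ eE`, for every member `W ∈ RegPr F n K e` (`0 < e ≤ eE`), every E′ recursion family `Q` and every `A`:
  `ℓ·Σ_ĉ‖Q (K−n) A ĉ‖² ≤ BE·Σ_b‖A b‖² + BE′·ℓ²·(CURL_HS + DIV_HS)(A) + BE″·e·Σ_b‖A b‖²` in ✓`Prop7EngOfTrueAvgBudget.hEng_of_trueAvgBudget`'s (QB) letters
  (`BE = 18`, `BE′ = 4800·L⁴`, `BE″ = 9.6·10¹⁰·L⁹`, `eE = (10⁶L⁵)⁻¹`).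

HONEST SCOPE.  A knit over landed rows with crude absolute∕L-only numerals; nothing of (QH1)♮'s corner-frame half, (REC), `hN06`, EX or the crux is proved here.

References: T. Bałaban, CMP 95 (1984) 17–40 [Balaban1984PropagatorsI] ((1.18)–(1.20) pp.19–20); CMP 98 (1985) 17–51 [Balaban1985Averaging] (Prop. 2 (53) p.26,
(124)–(126) p.36); CMP 99 (1985) 389–434 [Balaban1985BackgroundPropagators] (Thm 3.11 p.416, (3.14)–(3.15) p.393); CMP 102 (1985) 277–309 [Balaban1985Variational]
((14) p.280, (135) p.298).
-/

noncomputable section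

open scoped BigOperators Matrix.Norms.L2Operator Matrix

namespace Summit.QuantumFields.YangMills.Theorems.Prop7TrueLinIterH1RowOfRegPr

open Literature.MathematicalPhysics.QuantumFieldTheory.Balaban1983to89
open Literature.MathematicalPhysics.QuantumFieldTheory.Balaban1983to89.T3ContinuumYM3Torus
open Literature.MathematicalPhysics.QuantumFieldTheory.Balaban1983to89.T3PrintedRegularMinimiser (RegPr)
open Finset T4Continuum BlockAveraging AveragingRT ExpMeanLog BlockAveragingEMLLinearised BlockAveragingEMLLinearisedBackground BlockAveragingEMLProp2
open B1RG242Torus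
open B9Eq39Adjoint (curl divB)
open B10Eq27TorusAxialLog (unitsField toUField)
open B9TorusCalculus (torusT)
open Summit.QuantumFields.YangMills.Theorems.Prop7CovIterLambdaBound (tower_guard_of_le)
open Summit.QuantumFields.YangMills.Theorems.Prop7CovIterLambdaHLambdaBridge (one_div_le_deltaSU)
open Summit.QuantumFields.YangMills.Theorems.Prop7CovIterLambdaHLambdaCurl (sum_normSq_covIterLambda_le_curl_T3_su2)
open Summit.QuantumFields.YangMills.Theorems.Prop7TrueLinIterStructure (trueLinIter_structure)
open Summit.QuantumFields.YangMills.Theorems.Prop7CurvedLandauRowA (exists_reduced_family exists_coarseGauge_family)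
open Summit.QuantumFields.YangMills.Theorems.Prop7LineIterVsEngineOfTower (exists_pureLine_family)
open Summit.QuantumFields.YangMills.Theorems.Prop7TwistedLevelMassOfRegPr (plaq_le_of_regPr)
open Summit.QuantumFields.YangMills.Theorems.Prop7TrueLinReducedContraction (sum_normSq_covCoarseGrad_le ell_mul_sum_normSq_reduced_le_T3)

/-! ## §3 ★★★ The `H¹` row of `Q^{E′}` at a printed-regular member -/

set_option maxHeartbeats 400000 in
-- HEARTBEAT rule (README∕RULING №24 (a)): the (QB)-letter statement carries the ~25-line `hQs` binder and two five-fold lattice sums; elaboration + the knit measured > 100k; decl-local.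
/-- ★★★ **(QE′-H¹) THE `H¹` ROW OF THE TRUE LINEARISED AVERAGE AT A PRINTED-REGULAR MEMBER**, in the letters of ✓`Prop7EngOfTrueAvgBudget.hEng_of_trueAvgBudget`'s
displayed row (QB): for every `L > 1` there are L-only `BE = 18`, `BE′ = 4800·L⁴`, `BE″ = 9.6·10¹⁰·L⁹` and the radius `eE = (10⁶L⁵)⁻¹` such that for every member
(`F.L = L`, `n < K`, `ℓ = L^{K−n}`), every `0 < e ≤ eE`, every `W ∈ RegPr F n K e`, every E′ recursion family `Q` along the (0.4)-tower of `W` (`Q 0 = id`, the displayed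
one-step true linearisation) and every direction field `A`:
`ℓ·Σ_ĉ ‖Q (K−n) A ĉ‖² ≤ BE·Σ_b‖A b‖² + BE′·ℓ²·(CURL_HS(A) + DIV_HS(A)) + BE″·e·Σ_b‖A b‖²` — `Q^{E′}` is `H¹`-bounded in the `ℓ`-normalised currency (mass ⊕ curl ⊕ divergence
⊕ curvature·mass), uniformly in `K`, `n` and the volume.  Structure identity ⊕ reduced contraction (§2) ⊕ ★routeR-w2's curved N6 in curl∕div letters ⊕ §1.
[cite: Balaban1984PropagatorsI, (1.18)-(1.20) pp.19-20; Balaban1985BackgroundPropagators, Thm 3.11 p.416, (3.14)-(3.15) p.393; Balaban1985Variational, (14) p.280] -/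
theorem trueLinIter_H1_row_of_regPr : ∀ (L : ℕ), 1 < L → ∃ BE BE' BE'' eE : ℝ, 0 ≤ BE ∧ 0 ≤ BE' ∧ 0 ≤ BE'' ∧ 0 < eE ∧
    ∀ (F : T3Family), F.L = L → ∀ (n K : ℕ) (hnK : n < K) (e : ℝ) (W : GaugeField (F.P K) 0 (Matrix.specialUnitaryGroup (Fin 2) ℂ)),
      0 < e → e ≤ eE → RegPr F n K e W →
      ∀ (Q : (k : ℕ) → (PBond (F.P K) 0 → Matrix (Fin 2) (Fin 2) ℂ) → PBond (F.P K) k → Matrix (Fin 2) (Fin 2) ℂ), (∀ Y, Q 0 Y = Y) →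
      (∀ (k : ℕ) (Y : PBond (F.P K) 0 → Matrix (Fin 2) (Fin 2) ℂ) (c : PBond (F.P K) (k + 1)), Q (k + 1) Y c
        = (fderiv ℂ (eml : (Idx (F.P K) → Matrix (Fin 2) (Fin 2) ℂ) → Matrix (Fin 2) (Fin 2) ℂ)
              (fun i => ((loopHol (Averaging.iter (fun i => blockAvg (P := (F.P K)) (j := i) (expMeanLogSU (n := Fin 2))) k W) c i : Matrix.specialUnitaryGroup (Fin 2) ℂ) : Matrix (Fin 2) (Fin 2) ℂ))
              (fun i => covWalkSum (Averaging.iter (fun i => blockAvg (P := (F.P K)) (j := i) (expMeanLogSU (n := Fin 2))) k W) (Q k Y) (walk (emb c.src) (loopWord (F.P K).L c.dir (off i.1) i.2.1 i.2.2))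
                * ((loopHol (Averaging.iter (fun i => blockAvg (P := (F.P K)) (j := i) (expMeanLogSU (n := Fin 2))) k W) c i : Matrix.specialUnitaryGroup (Fin 2) ℂ) : Matrix (Fin 2) (Fin 2) ℂ))
              * star ((corr (expMeanLogSU (n := Fin 2)) (Averaging.iter (fun i => blockAvg (P := (F.P K)) (j := i) (expMeanLogSU (n := Fin 2))) k W) c : Matrix.specialUnitaryGroup (Fin 2) ℂ) : Matrix (Fin 2) (Fin 2) ℂ)
            + ((corr (expMeanLogSU (n := Fin 2)) (Averaging.iter (fun i => blockAvg (P := (F.P K)) (j := i) (expMeanLogSU (n := Fin 2))) k W) c : Matrix.specialUnitaryGroup (Fin 2) ℂ) : Matrix (Fin 2) (Fin 2) ℂ)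
              * covWalkSum (Averaging.iter (fun i => blockAvg (P := (F.P K)) (j := i) (expMeanLogSU (n := Fin 2))) k W) (Q k Y) (walk (emb c.src) (List.replicate (F.P K).L (c.dir, true)))
              * star ((corr (expMeanLogSU (n := Fin 2)) (Averaging.iter (fun i => blockAvg (P := (F.P K)) (j := i) (expMeanLogSU (n := Fin 2))) k W) c : Matrix.specialUnitaryGroup (Fin 2) ℂ) : Matrix (Fin 2) (Fin 2) ℂ))) →
      ∀ (A : PBond (F.P K) 0 → Matrix (Fin 2) (Fin 2) ℂ),
        (F.L : ℝ) ^ (K - n) * ∑ c : PBond (F.P K) (K - n), ‖Q (K - n) A c‖ ^ 2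
          ≤ BE * (∑ b : PBond (F.P K) 0, ‖A b‖ ^ 2)
            + BE' * ((F.L : ℝ) ^ (K - n)) ^ 2 * ((∑ x : Site (F.P K) 0, ∑ μ : Fin (F.P K).d, ∑ ν : Fin (F.P K).d,
                  (if μ < ν then ∑ j : Fin 2, ∑ k : Fin 2,
                    ‖(curl (torusT (F.P K) 0) (fun κ z => unitsField (toUField W) ⟨z, κ⟩) (fun κ z => A ⟨z, κ⟩) μ ν x) j k‖ ^ 2 else 0))
                + (∑ x : Site (F.P K) 0, ∑ j : Fin 2, ∑ k : Fin 2,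
                  ‖(divB (torusT (F.P K) 0) (fun κ z => unitsField (toUField W) ⟨z, κ⟩) (fun κ z => A ⟨z, κ⟩) x) j k‖ ^ 2))
            + BE'' * e * (∑ b : PBond (F.P K) 0, ‖A b‖ ^ 2) := by
  intro L hL
  refine ⟨18, 4800 * (L : ℝ) ^ 4, 96000000000 * (L : ℝ) ^ 9, (1000000 * (L : ℝ) ^ 5)⁻¹, by norm_num, by positivity, by positivity,
    by positivity, ?_⟩
  intro F hFL n K hnK e W he heE hreg Q hQ0 hQs A
  subst hFL
  have hL0 : (0 : ℝ) < (F.L : ℝ) := by have := F.hL.2; positivity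
  have heL : 1000000 * (F.L : ℝ) ^ 5 * e ≤ 1 := by
    have h5 : (0 : ℝ) < 1000000 * (F.L : ℝ) ^ 5 := by positivity
    calc 1000000 * (F.L : ℝ) ^ 5 * e ≤ 1000000 * (F.L : ℝ) ^ 5 * (1000000 * (F.L : ℝ) ^ 5)⁻¹ := mul_le_mul_of_nonneg_left heE h5.le
      _ = 1 := by field_simp
  have hU : ∀ p : Plaq (F.P K) 0, dist1 (GaugeField.plaqHol W p) ≤ e * ((((F.L : ℝ) ^ (K - n))) ^ 2)⁻¹ := plaq_le_of_regPr F n K hreg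
  -- the families of the curved structure theorem
  obtain ⟨G, hG0, hGs⟩ := exists_reduced_family W A
  obtain ⟨Λ, hΛ0, hΛs⟩ := exists_coarseGauge_family W G
  obtain ⟨S, hS0, hSs⟩ := exists_pureLine_family W A
  -- the (0.4) guards along the tower (at `2e`)
  have hd : (F.P K).d = 3 := T3ContinuumYM3Torus.T3Family.P_d F K
  have hL3 : 3 ≤ (F.P K).L := by
    show 3 ≤ F.L
    obtain ⟨⟨m, hm⟩, h1⟩ := F.hL
    omega
  have hL3r : (3 : ℝ) ≤ ((F.P K).L : ℝ) := by exact_mod_cast hL3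
  have hLF : ((F.P K).L : ℝ) = (F.L : ℝ) := by norm_cast
  have hL5 : (243 : ℝ) ≤ (F.L : ℝ) ^ 5 := by rw [← hLF]; nlinarith [pow_le_pow_left₀ (by norm_num : (0 : ℝ) ≤ 3) hL3r 5]
  have hεs : 243000000 * e ≤ 1 := by
    have := mul_le_mul_of_nonneg_right hL5 (by positivity : (0 : ℝ) ≤ 1000000 * e)
    linarith
  have hε' : 0 < 2 * e := by linarith
  have hε3 : (143 * (((((F.P K).d + 4 : ℕ) : ℝ)) ^ 2 / 4) ^ 2) * (2 * e) ≤ 1 / 3 := by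
    rw [hd, show (143 * ((((3 + 4 : ℕ) : ℝ)) ^ 2 / 4) ^ 2) = 343343 / 16 by norm_num]
    linarith
  have hεL2 : ((F.P K).L : ℝ) ^ 2 * e * 1000000 ≤ 1 := by
    rw [hLF]
    have hL1 : (1 : ℝ) ≤ F.L := by rw [← hLF]; linarith
    have h1 : (F.L : ℝ) ^ 2 ≤ (F.L : ℝ) ^ 5 := by
      calc (F.L : ℝ) ^ 2 = (F.L : ℝ) ^ 2 * 1 := by ring
        _ ≤ (F.L : ℝ) ^ 2 * (F.L : ℝ) ^ 3 := mul_le_mul_of_nonneg_left (one_le_pow₀ hL1) (by positivity)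
        _ = (F.L : ℝ) ^ 5 := by ring
    nlinarith [mul_le_mul_of_nonneg_right h1 (by positivity : (0:ℝ) ≤ e)]
  have hε2 : 2 * (2 * e) ≤ 2 * deltaSU (Fin 2) / ((((F.P K).d + 4) * (F.P K).L : ℕ) : ℝ) ^ 2 := by
    have hδ := one_div_le_deltaSU 2
    rw [hd, le_div_iff₀ (by positivity)]
    push_cast
    have h1 : 98 * ((F.P K).L : ℝ) ^ 2 * e ≤ 1 / (3 * (2 : ℕ)) := by
      rw [le_div_iff₀ (by positivity)]
      push_cast
      nlinarith [hεL2]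
    have ee : 2 * (2 * e) * (7 * ((F.P K).L : ℝ)) ^ 2 = 2 * (98 * ((F.P K).L : ℝ) ^ 2 * e) := by ring
    rw [ee]
    have : (1 : ℝ) / (3 * (2 : ℕ)) ≤ deltaSU (Fin 2) := by exact_mod_cast hδ
    linarith
  have hU' : ∀ p : Plaq (F.P K) 0, dist1 (GaugeField.plaqHol W p) ≤ e * (((((F.P K).L : ℝ) ^ (K - n))) ^ 2)⁻¹ := by
    rw [hLF]; exact hU
  have hg := tower_guard_of_le (P := F.P K) (n := Fin 2) (K - n) (by linarith : e < 2 * e) hε' hε3 hε2 hU'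
  -- the structure identity `Q = G + (Λ(c₋) − Ū Λ(c₊) Ū*)`
  have hstruct := trueLinIter_structure W Q hQ0 hQs A
    (fun k Gk z => ((Fintype.card (Idx (F.P K)) : ℂ))⁻¹ • ∑ i : Idx (F.P K),
      covWalkSum (Averaging.iter (fun i => blockAvg (P := F.P K) (j := i) (expMeanLogSU (n := Fin 2))) k W) Gk
        (walk (emb z) (stairWord i.2.1 (off i.1))))
    G Λ hG0 hΛ0 hΛs hGs (K - n) hg
  -- the three rows
  have hG := ell_mul_sum_normSq_reduced_le_T3 F n K W he heL hU A G S hG0 hS0 hGs hSs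
  have hΛ := sum_normSq_covIterLambda_le_curl_T3_su2 F n K W he heL hU A G S Λ hΛ0 hG0 hS0 hΛs hGs hSs
  have hX := sum_normSq_covCoarseGrad_le
    (fun c : PBond (F.P K) (K - n) => Averaging.iter (fun i => blockAvg (P := F.P K) (j := i) (expMeanLogSU (n := Fin 2))) (K - n) W c) (Λ (K - n))
  rw [hd] at hX
  -- the split `‖Q‖² ≤ 2‖G‖² + 2‖X‖²`
  have hsplit : ∑ c : PBond (F.P K) (K - n), ‖Q (K - n) A c‖ ^ 2
      ≤ 2 * ∑ c : PBond (F.P K) (K - n), ‖G (K - n) c‖ ^ 2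
        + 2 * ∑ c : PBond (F.P K) (K - n), ‖Λ (K - n) c.src
            - ((Averaging.iter (fun i => blockAvg (P := F.P K) (j := i) (expMeanLogSU (n := Fin 2))) (K - n) W c :
                Matrix.specialUnitaryGroup (Fin 2) ℂ) : Matrix (Fin 2) (Fin 2) ℂ) * Λ (K - n) c.tgt
              * star ((Averaging.iter (fun i => blockAvg (P := F.P K) (j := i) (expMeanLogSU (n := Fin 2))) (K - n) W c :
                Matrix.specialUnitaryGroup (Fin 2) ℂ) : Matrix (Fin 2) (Fin 2) ℂ)‖ ^ 2 := by
    rw [Finset.mul_sum, Finset.mul_sum, ← Finset.sum_add_distrib]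
    refine Finset.sum_le_sum fun c _ => ?_
    rw [hstruct c]
    have h := norm_add_le (G (K - n) c) (Λ (K - n) c.src
            - ((Averaging.iter (fun i => blockAvg (P := F.P K) (j := i) (expMeanLogSU (n := Fin 2))) (K - n) W c :
                Matrix.specialUnitaryGroup (Fin 2) ℂ) : Matrix (Fin 2) (Fin 2) ℂ) * Λ (K - n) c.tgt
              * star ((Averaging.iter (fun i => blockAvg (P := F.P K) (j := i) (expMeanLogSU (n := Fin 2))) (K - n) W c :
                Matrix.specialUnitaryGroup (Fin 2) ℂ) : Matrix (Fin 2) (Fin 2) ℂ))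
    have ha := norm_nonneg (G (K - n) c)
    have hb := norm_nonneg (Λ (K - n) c.src
            - ((Averaging.iter (fun i => blockAvg (P := F.P K) (j := i) (expMeanLogSU (n := Fin 2))) (K - n) W c :
                Matrix.specialUnitaryGroup (Fin 2) ℂ) : Matrix (Fin 2) (Fin 2) ℂ) * Λ (K - n) c.tgt
              * star ((Averaging.iter (fun i => blockAvg (P := F.P K) (j := i) (expMeanLogSU (n := Fin 2))) (K - n) W c :
                Matrix.specialUnitaryGroup (Fin 2) ℂ) : Matrix (Fin 2) (Fin 2) ℂ))
    have h2 := pow_le_pow_left₀ (norm_nonneg _) h 2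
    nlinarith [sq_nonneg (‖G (K - n) c‖ - ‖Λ (K - n) c.src
            - ((Averaging.iter (fun i => blockAvg (P := F.P K) (j := i) (expMeanLogSU (n := Fin 2))) (K - n) W c :
                Matrix.specialUnitaryGroup (Fin 2) ℂ) : Matrix (Fin 2) (Fin 2) ℂ) * Λ (K - n) c.tgt
              * star ((Averaging.iter (fun i => blockAvg (P := F.P K) (j := i) (expMeanLogSU (n := Fin 2))) (K - n) W c :
                Matrix.specialUnitaryGroup (Fin 2) ℂ) : Matrix (Fin 2) (Fin 2) ℂ)‖)]
  -- bookkeeping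
  set ℓ : ℝ := (F.L : ℝ) ^ (K - n) with hℓ
  have hℓ0 : 0 < ℓ := pow_pos hL0 _
  set M : ℝ := ∑ b : PBond (F.P K) 0, ‖A b‖ ^ 2 with hM
  set CD : ℝ := (∑ x : Site (F.P K) 0, ∑ μ : Fin (F.P K).d, ∑ ν : Fin (F.P K).d,
                  (if μ < ν then ∑ j : Fin 2, ∑ k : Fin 2,
                    ‖(curl (torusT (F.P K) 0) (fun κ z => unitsField (toUField W) ⟨z, κ⟩) (fun κ z => A ⟨z, κ⟩) μ ν x) j k‖ ^ 2 else 0))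
                + (∑ x : Site (F.P K) 0, ∑ j : Fin 2, ∑ k : Fin 2,
                  ‖(divB (torusT (F.P K) 0) (fun κ z => unitsField (toUField W) ⟨z, κ⟩) (fun κ z => A ⟨z, κ⟩) x) j k‖ ^ 2) with hCD
  set SΛ : ℝ := ∑ y : Site (F.P K) (K - n), ‖Λ (K - n) y‖ ^ 2 with hSΛ
  set SG : ℝ := ∑ c : PBond (F.P K) (K - n), ‖G (K - n) c‖ ^ 2 with hSG
  set SX : ℝ := ∑ c : PBond (F.P K) (K - n), ‖Λ (K - n) c.src
            - ((Averaging.iter (fun i => blockAvg (P := F.P K) (j := i) (expMeanLogSU (n := Fin 2))) (K - n) W c :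
                Matrix.specialUnitaryGroup (Fin 2) ℂ) : Matrix (Fin 2) (Fin 2) ℂ) * Λ (K - n) c.tgt
              * star ((Averaging.iter (fun i => blockAvg (P := F.P K) (j := i) (expMeanLogSU (n := Fin 2))) (K - n) W c :
                Matrix.specialUnitaryGroup (Fin 2) ℂ) : Matrix (Fin 2) (Fin 2) ℂ)‖ ^ 2 with hSX
  have hM0 : 0 ≤ M := Finset.sum_nonneg fun _ _ => sq_nonneg _
  have hCD0 : 0 ≤ CD := by
    refine add_nonneg (Finset.sum_nonneg fun _ _ => Finset.sum_nonneg fun _ _ => Finset.sum_nonneg fun _ _ => ?_)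
      (Finset.sum_nonneg fun _ _ => Finset.sum_nonneg fun _ _ => Finset.sum_nonneg fun _ _ => sq_nonneg _)
    split_ifs
    · exact Finset.sum_nonneg fun _ _ => Finset.sum_nonneg fun _ _ => sq_nonneg _
    · exact le_rfl
  have hSΛ0 : 0 ≤ SΛ := Finset.sum_nonneg fun _ _ => sq_nonneg _
  -- `Σ‖Λ‖² ≤ ℓ·(200·L⁴·CD + 4·10⁹·L⁹·e·ℓ⁻²·M)`
  have hΛ' : SΛ ≤ ℓ * (200 * (F.L : ℝ) ^ 4 * CD) + 4000000000 * (F.L : ℝ) ^ 9 * e * (ℓ * (ℓ ^ 2)⁻¹) * M := by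
    have e1 : 1 * (F.L : ℝ) ^ (K - n) * (100 * ((2 : ℕ) : ℝ) * (F.L : ℝ) ^ 4 * CD
          + 10 ^ 9 * ((2 : ℕ) : ℝ) ^ 2 * (F.L : ℝ) ^ 9 * e * (((F.L : ℝ) ^ (K - n)) ^ 2)⁻¹ * M)
        = ℓ * (200 * (F.L : ℝ) ^ 4 * CD) + 4000000000 * (F.L : ℝ) ^ 9 * e * (ℓ * (ℓ ^ 2)⁻¹) * M := by
      push_cast; rw [hℓ]; ring
    rw [← e1]; exact hΛ
  have hℓℓ : ℓ * (ℓ * (ℓ ^ 2)⁻¹) = 1 := by field_simp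
  -- assemble
  have h1 : ℓ * ∑ c : PBond (F.P K) (K - n), ‖Q (K - n) A c‖ ^ 2 ≤ 2 * (ℓ * SG) + 2 * (ℓ * SX) := by nlinarith [hsplit, hℓ0.le]
  have h2 : ℓ * SX ≤ 12 * (ℓ * SΛ) := by push_cast at hX; nlinarith [hX, hℓ0.le]
  have h3 : ℓ * SΛ ≤ ℓ * ℓ * (200 * (F.L : ℝ) ^ 4 * CD) + 4000000000 * (F.L : ℝ) ^ 9 * e * M := by
    have := mul_le_mul_of_nonneg_left hΛ' hℓ0.le
    have e2 : ℓ * (ℓ * (200 * (F.L : ℝ) ^ 4 * CD) + 4000000000 * (F.L : ℝ) ^ 9 * e * (ℓ * (ℓ ^ 2)⁻¹) * M)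
        = ℓ * ℓ * (200 * (F.L : ℝ) ^ 4 * CD) + 4000000000 * (F.L : ℝ) ^ 9 * e * M * (ℓ * (ℓ * (ℓ ^ 2)⁻¹)) := by ring
    rw [e2, hℓℓ, mul_one] at this
    exact this
  have h4 : ℓ * SG ≤ 9 * M := hG
  calc ℓ * ∑ c : PBond (F.P K) (K - n), ‖Q (K - n) A c‖ ^ 2
      ≤ 2 * (9 * M) + 2 * (12 * (ℓ * ℓ * (200 * (F.L : ℝ) ^ 4 * CD) + 4000000000 * (F.L : ℝ) ^ 9 * e * M)) := by
        linarith [h1, h2, h3, h4]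
    _ = 18 * M + 4800 * (F.L : ℝ) ^ 4 * ℓ ^ 2 * CD + 96000000000 * (F.L : ℝ) ^ 9 * e * M := by ring

end Summit.QuantumFields.YangMills.Theorems.Prop7TrueLinIterH1RowOfRegPr

end
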